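import Summits.QuantumFields.BalabanUV.Beta.FP.TorusCompositeIndexWardTwoLetter
import Summits.QuantumFields.BalabanUV.Beta.FP.TorusCompositeCovarianceTwoRows
import Summits.QuantumFields.BalabanUV.Beta.FP.NestedDeadRowsOrderTwoTowerClosed

/-!
# `BalabanUV.Beta.FP.NestedStepLawTorusCompositeOneShotTopPure` — road «FP» for binder row D1, ROUTE T: **#21♭ — THE (j, m ≥ 2) TORUS CALL #21 WITH THE ♭
# COMPOSITE TOWER's ROWS DISCHARGED BY TERM** (`c1 d1` C2, `c2 d2` I-5, `q1` g22, `q2` R-3): displayed ONLY the form side's letters (`k1 k2 hH₁t hH₂t`, leaf-05's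
# `a1 a2`), leaf-06's `uTop`, the pins and the namings; conclusion #21's VERBATIM (the composite analogue of my g24 U23♭ ∕ U22♭ for the one-step doors)

WHY.  #21 `NestedStepLawTorusCompositeOneShotTop.secondVar_oneShot_nestedStepLaw_torus_composite_graded_oneShot_of_uTop` (OWNER d1-p3 g21, p335338 ✓) displays, per
direction `h`, the (COV-m) rows `c1 c2 d1 d2` and the (T-β-m) letters `q1 q2` with FREE matrices `Q₁₁ Q₁₂ Q₂₁ Q₂₂ Db₁ Db₂ Xbar` and implicit `𝔔′₁ 𝔔′₂`.  This lineage's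
ROUTE T tower supplies every one of them BY TERM for OUR ♭ objects: `Q₁₁ := c • compIns₁ h`, `Db₁` (C2 `TorusCompositeCovarianceOneRows.torus_c1_tower ∕ torus_d1_tower`),
`Q₁₂ := c² • compIns₂ h`, `Db₂` = the PURE SQUARE, `Q₂₂ := c_{lev 0} •` the top step's one-summand bi-member (I-5 `TorusCompositeCovarianceTwoRows.torus_c2_tower ∕
torus_d2_tower`), `Q₂₁` + `Xbar := c • R′` + `𝔔′₁` (g22 `TorusCompositeIndexWardOne.torus_q1_tower`), `𝔔′₂` (R-3 `TorusCompositeIndexWardTwoLetter.torus_q2_tower`);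
`Xbar` therefore disappears from the displayed letters (it only served `q1 q2`).
So the OWNER's `j ≥ 2` assembly (#41) can take the composite door as ONE hypothesis-light theorem, exactly as #37 took U23♭.

WHAT.  `secondVar_oneShot_nestedStepLaw_torus_composite_graded_oneShot_of_uTop_pure`: #21's signature with `Q₁₁ Q₁₂ Q₂₁ Q₂₂ Db₁ Db₂` turned into
letters BOUND by displayed defining equations (`hQ₁₁ hQ₁₂`, `Q₂₁f hQ₂₁f hQ₂₁`, `Q₂₂f hQ₂₂f hQ₂₂`, `hDb₁ hDb₂` — leaf-06 `NestedDeadRowsOrderTwoTowerClosed`'s shapes), `Xbar` GONE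
(the coarse transport is internal to `q1 q2`: g22's `c • R′`),
`q1 q2` replaced by the namings `h𝔔′₁ h𝔔′₂` of the jets at `h + Dλ`, `c1 c2 d1 d2` GONE; everything else (pins, `H₁ H₂`, `lam c h`, `W₁ W₂ W′₁ W′₂ C₁ C₂`, `h𝔔₀ h𝔔₁ h𝔔₂`,
`k1 k2`, `hΓ hI hL hS hB`, `uTop`, `hH₁t hH₂t`, `a1 a2`) and the CONCLUSION — VERBATIM.  Proof: `subst` the bindings, then #21 with the six rows supplied by the four
files; and `…_of_uTop_pure_closed`: the same for the NESTED COMPOSITE COLUMN of a coarse source `h̄` (leaf-06's `hbar hv hh` VERBATIM) with `uTop` DISCHARGED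
by leaf-06 g27 `NestedDeadRowsOrderTwoTowerClosed.torus_uTop_tower_closed` — displayed then ONLY the form side (`k1 k2 hH₁t hH₂t a1 a2`) + pins + namings.
[folklore] composition BY NAME; no `def`, no `def … : Prop`, nothing cited, 0 sorry.  The ♭ objects are OURS and CANDIDATE (R-FP-63 (v)); the door of record
stays #21; `uTop` is closed for nested columns by leaf-06 `torus_uTop_tower_closed` (same `hDb₁ hDb₂`), `a1 a2` are leaf-05's — not touched here.

HONEST DEPENDENCY (page 1, mandatory): continuum YM on T⁴ ⇐ BetaPertH ∧ nine spine estimates (0/9 proved); BetaPertH ⇐ (D1) ∧ (D4) ∧ CAP+tail;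
G-an2-4 gates asym, D1 and NE2/3/4.  HONEST FRAMING (cell contract, verbatim): «discharging `BetaPertH` makes Bałaban's UV stability UNCONDITIONAL —
a real constructive-QFT result; it is NOT the continuum limit and NOT the Clay problem.»  ABSOLUTE RULE (cell charter, verbatim): «No internally-minted
statement may enter as a cited fact. Every hypothesis is either kernel-proved in this package or a verbatim quotation of a PUBLISHED theorem with page
reference. The manuscript(s) under audit are NOT citable for their own disputed steps — they are the thing under adjudication; programme-internal
(2001/route/tribunal) claims are never citable.»  0 estimates; 0∕4 row-D1 binders (hW, hR, D1Tel, D1Rep); NOT (T-ID), NOT (J-a) complete, NOT SDF, NOT D1,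
NOT BetaPertH, NOT continuum, NOT Clay.  D1 formalisation swarm LEAF PROVER 02 (b2b-balaban-beta-d1-formalise-leaf-02 gen 26), 2026-08-23.  No existing file touched.
-/

noncomputable section

namespace Summit.QuantumFields.BalabanUV.Beta.FP.NestedStepLawTorusCompositeOneShotTopPure

open Matrix Finset
open scoped BigOperators
open Literature.Probability.LatticeModels (Torus.proj)
open Literature.MathematicalPhysics.QuantumFieldTheory.Balaban1983to89
open Literature.MathematicalPhysics.QuantumFieldTheory.Balaban1983to89.Beta
open Literature.MathematicalPhysics.QuantumFieldTheory.Balaban1983to89.Beta.Composition (kkt)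
open Literature.MathematicalPhysics.QuantumFieldTheory.Balaban1983to89.Beta.CompositionSingular (effForm flucCov minOp minOpL)
open B4TorusKernel.MultiPeriod (translate)
open B5Prop11Plancherel (fine)
open B6Lemma24Torus (pbox)
open AffineAveraging (Site box toSite unitVec)
open AveragingHessianKernelsRooted (vhSAt)
open AveragingMixedJetTables (vh₂SAt)
open OneStepResolventKernel (Fib)
open Summit.QuantumFields.BalabanUV.Beta.BorderedHessian (bhKStepAt stepScale)
open Summit.QuantumFields.BalabanUV.Beta.D1BFx.LogDetSecondVariation (secondVar)
open Summit.QuantumFields.BalabanUV.Beta.FP.KernelPeriodisationFib (Idx perF)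
open Summit.QuantumFields.BalabanUV.Beta.FP.KernelPeriodisationFibLoc (dper)
open Summit.QuantumFields.BalabanUV.Beta.FP.TorusCombRows (Res)
open Summit.QuantumFields.BalabanUV.Beta.FP.TorusGaugeCovariance (tgrad tdelta)
open Summit.QuantumFields.BalabanUV.Beta.FP.TorusCompositeObjects (towerTorus compRows NParam combF bigP towerGen)
open Summit.QuantumFields.BalabanUV.Beta.FP.TorusCompositeCovariance (itRoot)
open Summit.QuantumFields.BalabanUV.Beta.FP.TorusCompositeFP (evalN)
open Summit.QuantumFields.BalabanUV.Beta.FP.TorusCompositeIntertwining (towerC₁)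
open Summit.QuantumFields.BalabanUV.Beta.FP.TorusCompositeCovarianceOne (compIns₁)
open Summit.QuantumFields.BalabanUV.Beta.FP.TorusCompositeCovarianceTwo (compIns₂)
open Summit.QuantumFields.BalabanUV.Beta.FP.TorusCompositeCovarianceOneRows (torus_c1_tower torus_d1_tower)
open Summit.QuantumFields.BalabanUV.Beta.FP.TorusCompositeCovarianceTwoRows (torus_c2_tower torus_d2_tower)
open Summit.QuantumFields.BalabanUV.Beta.FP.TorusCompositeIndexWardOne (torus_q1_tower)
open Summit.QuantumFields.BalabanUV.Beta.FP.TorusCompositeIndexWardTwoLetter (torus_q2_tower)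
open Summit.QuantumFields.BalabanUV.Beta.FP.NestedStepLawTorusCompositeOneShotTop (secondVar_oneShot_nestedStepLaw_torus_composite_graded_oneShot_of_uTop)
open Summit.QuantumFields.BalabanUV.Beta.FP.NestedDeadRowsOrderTwoTowerClosed (torus_uTop_tower_closed)
open Summit.QuantumFields.BalabanUV.Beta.GAN24.FineReadoutCauchyFrame (toSite_mem_range)

variable {d : ℕ}

section Pure

variable (M' : Fin (d + 1) → ℕ) [∀ μ, NeZero (M' μ)] (Lc : ℕ) [NeZero Lc] (lev : ℕ → ℕ) (rs : ℕ → (Fin (d + 1) → ℕ)) (n : ℕ)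

set_option synthInstance.maxSize 1024 in
/-- [folklore] **#21♭ — THE (j, m ≥ 2) TORUS CALL WITH THE ♭ COMPOSITE TOWER's ROWS DISCHARGED BY TERM.**  #21's binders and conclusion VERBATIM except: `Q₁₁ Q₁₂ Q₂₁ Q₂₂ Db₁ Db₂`
BOUND by the displayed equations `hQ₁₁ hQ₁₂ hQ₂₁f hQ₂₁ hQ₂₂f hQ₂₂ hDb₁ hDb₂`, `Xbar` GONE (internal to `q1 q2`, g22's `c • R′`) (OUR ♭ objects: C2 ∕ I-5 ∕ g22 ∕ R-3's shapes), `q1 q2` replaced by the namings `h𝔔′₁ h𝔔′₂` of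
the composite's jets at `h + Dλ`, and `c1 c2 d1 d2` DISCHARGED (`torus_c1_tower ∕ torus_d1_tower ∕ torus_c2_tower ∕ torus_d2_tower`); `q1 q2` by `torus_q1_tower ∕ torus_q2_tower`.
Displayed: pins, `H₁ H₂`, `lam c h`, the exponential generator jets, `h𝔔₀ h𝔔₁ h𝔔₂`, `k1 k2`, `hΓ hI hL hS hB`, `uTop` (leaf-06: `torus_uTop_tower_closed` for nested columns),
`hH₁t hH₂t`, `a1 a2` (leaf-05). -/
theorem secondVar_oneShot_nestedStepLaw_torus_composite_graded_oneShot_of_uTop_pure (hrs : ∀ k, rs k ∈ box (d + 1) Lc) (hlev : ∀ i, lev i = lev (i + 1) + 1)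
    (hM' : ∀ i, Lc ∣ M' i)
    -- the coarse multipliers' slot presentation one level above `M′` (as (B): injective, `inr`-valued, exactly the `Lc`-coarse sites of `M′`)
    {κ : Type*} [Fintype κ] [DecidableEq κ] (pμ' : κ → ↥(pbox M')) (mμ' : κ → Fin (d + 1))
    (hfμ' : Function.Injective (fun a : κ => ((pμ' a, Sum.inr (mμ' a)) : Idx M' (Fib d))))
    (hcoarse' : ∀ (s : ↥(pbox M')) (m : Fin (d + 1)),
      ((s, Sum.inr m) : Idx M' (Fib d)) ∈ Set.range (fun a : κ => ((pμ' a, Sum.inr (mμ' a)) : Idx M' (Fib d))) ↔ Torus.proj Lc (s : Site (d + 1)) = 0)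
    -- the composite objects of record, PINNED by defining equations (leaf-06 `TorusCompositeObjects`)
    {H₀ : Matrix (↥(pbox (towerTorus Lc M' (n + 1))) × Fin (d + 1)) (↥(pbox (towerTorus Lc M' (n + 1))) × Fin (d + 1)) ℝ}
    {Q₁₀ : Matrix (↥(pbox M') × Fin (d + 1)) (↥(pbox (towerTorus Lc M' (n + 1))) × Fin (d + 1)) ℝ}
    {τ₁ : Matrix (NParam Lc (fine Lc M') (fun k => rs (k + 1)) n) (↥(pbox (towerTorus Lc M' (n + 1))) × Fin (d + 1)) ℝ}
    (hH₀ : H₀ = (perF (towerTorus Lc M' (n + 1)) (bhKStepAt d (toSite (rs (n + 1))) Lc (lev (n + 1)))).submatrix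
        (fun b : ↥(pbox (towerTorus Lc M' (n + 1))) × Fin (d + 1) => ((b.1, Sum.inl b.2) : Idx (towerTorus Lc M' (n + 1)) (Fib d)))
        (fun b : ↥(pbox (towerTorus Lc M' (n + 1))) × Fin (d + 1) => ((b.1, Sum.inl b.2) : Idx (towerTorus Lc M' (n + 1)) (Fib d))))
    (hQ₁₀ : Q₁₀ = compRows Lc M' lev rs (n + 1))
    -- R-FP-55 (α): the fine slice is the ONE-SHOT big comb of the tower below (leaf-06 `bigP`), NOT the nested slice
    (hτ₁ : τ₁ = bigP Lc (fine Lc M') (fun k => rs (k + 1)) (fun k => toSite_mem_range (hrs (k + 1))) n)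
    {τ₂ : Matrix (Res (toSite (rs 0)) Lc M') (↥(pbox M') × Fin (d + 1)) ℝ} (hτ₂ : τ₂ = combF Lc M' (rs 0))
    -- the top step's averaging rows (level `lev 0`, root `rs 0`), PINNED as (B)'s `hQ₂₀`
    {Q₂₀ : Matrix κ (↥(pbox M') × Fin (d + 1)) ℝ}
    (hQ₂₀ : Q₂₀ = (perF M' (bhKStepAt d (toSite (rs 0)) Lc (lev 0))).submatrix (fun a : κ => ((pμ' a, Sum.inr (mμ' a)) : Idx M' (Fib d)))
        (fun b : ↥(pbox M') × Fin (d + 1) => ((b.1, Sum.inl b.2) : Idx M' (Fib d))))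
    -- the tower's generators and the one-shot big comb: FREE matrices of the tower's types in v1 (pinned to leaf-06's `towerGen ∕ bigP` by the (SLICE-m) ∕
    -- (COV-m) suppliers in v1.1; target shape 36f428fe4d8b64c2)
    {W₀ : Matrix (↥(pbox (towerTorus Lc M' (n + 1))) × Fin (d + 1)) (NParam Lc M' rs (n + 1)) ℝ} (hW₀ : W₀ = towerGen Lc M' rs (n + 1))
    {P : Matrix (NParam Lc M' rs (n + 1)) (↥(pbox (towerTorus Lc M' (n + 1))) × Fin (d + 1)) ℝ} (hP : P = bigP Lc M' rs (fun k => toSite_mem_range (hrs k)) (n + 1))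
    -- the displayed jets: form (finest level), composite averaging, the top step's averaging jets, generators, witnesses, composite covariance images
    (H₁ H₂ : Matrix (↥(pbox (towerTorus Lc M' (n + 1))) × Fin (d + 1)) (↥(pbox (towerTorus Lc M' (n + 1))) × Fin (d + 1)) ℝ)
    -- (COV-m) ∕ (T-β-m) ORDERS 1, 2 BOUND (this file): the composite averaging's insertion jets `Q₁₁ Q₁₂` and the top step's `Q₂₁ Q₂₂` by DEFINING EQUATIONS below
    {Q₁₁ Q₁₂ : Matrix (↥(pbox M') × Fin (d + 1)) (↥(pbox (towerTorus Lc M' (n + 1))) × Fin (d + 1)) ℝ}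
    {Q₂₁ Q₂₂ : Matrix κ (↥(pbox M') × Fin (d + 1)) ℝ}
    -- the finest-level transport generator `X = −c·diag(λ)`, the tower's generator jets `W₁ W₂` (weight `h`) and the one-shot generator jets `W′₁ W′₂`
    -- (weight `h + Dλ`) PINNED to the exponential closed forms of leaf-06's `TorusCompositeIntertwining` ∕ `TorusCompositeFP` (parameters `λ`, `c`, `h`)
    (lam : ↥(pbox (towerTorus Lc M' (n + 1))) → ℝ) (c : ℝ) (h : (↥(pbox (towerTorus Lc M' (n + 1))) × Fin (d + 1)) → ℝ)
    {W₁ W₂ : Matrix (↥(pbox (towerTorus Lc M' (n + 1))) × Fin (d + 1)) (NParam Lc M' rs (n + 1)) ℝ}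
    (hW₁ : W₁ = Matrix.of fun (b : (↥(pbox (towerTorus Lc M' (n + 1))) × Fin (d + 1))) (e : NParam Lc M' rs (n + 1)) => -(c * h b * evalN Lc M' rs (n + 1) (fun b' : (↥(pbox (towerTorus Lc M' (n + 1))) × Fin (d + 1)) => (b'.1 : Site (d + 1)) + unitVec b'.2) b e))
    (hW₂ : W₂ = Matrix.of fun (b : (↥(pbox (towerTorus Lc M' (n + 1))) × Fin (d + 1))) (e : NParam Lc M' rs (n + 1)) => (c * h b) ^ 2 * evalN Lc M' rs (n + 1) (fun b' : (↥(pbox (towerTorus Lc M' (n + 1))) × Fin (d + 1)) => (b'.1 : Site (d + 1)) + unitVec b'.2) b e)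
    -- (COV-m) ORDER 0 PINNED (leaf-02 g21 `TorusCompositeCovariance`): `Dbar := σ_{n+1} • D̄`; the orders 1, 2 images stay displayed
    {Dbar : Matrix (↥(pbox M') × Fin (d + 1)) (Res (toSite (rs 0)) Lc M') ℝ}
    (hDbar : Dbar = (∏ i ∈ range (n + 1), (stepScale d Lc (lev (i + 1)) * ((box (d + 1) Lc).card : ℝ))) •
        (tgrad M').submatrix (fun a : ↥(pbox M') × Fin (d + 1) => ((a.1, Sum.inl a.2) : Idx M' (Fib d))) (fun t : Res (toSite (rs 0)) Lc M' => (t.1 : ↥(pbox M'))))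
    {Db₁ Db₂ : Matrix (↥(pbox M') × Fin (d + 1)) (Res (toSite (rs 0)) Lc M') ℝ}
    (hDb₁ : Db₁ = Matrix.of fun (a : ↥(pbox M') × Fin (d + 1)) (t : Res (toSite (rs 0)) Lc M') =>
        -(c * (compRows Lc M' lev rs (n + 1) *ᵥ h) a * tdelta M' ((a.1 : Site (d + 1)) + unitVec a.2) t.1))
    (hDb₂ : Db₂ = Matrix.of fun (a : ↥(pbox M') × Fin (d + 1)) (t : Res (toSite (rs 0)) Lc M') =>
        (c ^ 2 * (∏ i ∈ range (n + 1), (stepScale d Lc (lev (i + 1)) * ((box (d + 1) Lc).card : ℝ)))⁻¹)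
          * ((compRows Lc M' lev rs (n + 1) *ᵥ h) a) ^ 2 * tdelta M' ((a.1 : Site (d + 1)) + unitVec a.2) t.1)
    -- the bindings of `Q₁₁ Q₁₂` (C2 ∕ I-5: OUR composite insertion jets along `h`) and of `Q₂₁ Q₂₂` (the top step's rooted member ∕ ♭ bi-member along the
    -- transported direction `(cθ_{n+1})•(compRows·w)`, as FUNCTIONS of the weight(s) — g22 `torus_q1_tower` ∕ I-5 ∕ R-3 `torus_q2_tower` shapes)
    (hQ₁₁ : Q₁₁ = c • compIns₁ Lc M' lev rs (n + 1) h) (hQ₁₂ : Q₁₂ = c ^ 2 • compIns₂ Lc M' lev rs (n + 1) h)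
    (Q₂₁f : ((↥(pbox (towerTorus Lc M' (n + 1))) × Fin (d + 1)) → ℝ) → Matrix κ (↥(pbox M') × Fin (d + 1)) ℝ)
    (hQ₂₁f : ∀ w, Q₂₁f w = ∑ a' : ↥(pbox M') × Fin (d + 1),
        ((c * (((Lc : ℝ) ^ (d + 1) * stepScale d Lc (lev 0)) * (∏ i ∈ range (n + 1), (stepScale d Lc (lev (i + 1)) * ((box (d + 1) Lc).card : ℝ)))⁻¹))
          * (compRows Lc M' lev rs (n + 1) *ᵥ w) a') •
        (perF M' (dper M' (vhSAt (toSite (rs 0)) d Lc rfl a'.2 (a'.1 : Site (d + 1))))).submatrix (fun k : κ => ((pμ' k, Sum.inr (mμ' k)) : Idx M' (Fib d)))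
          (fun b : ↥(pbox M') × Fin (d + 1) => ((b.1, Sum.inl b.2) : Idx M' (Fib d))))
    (Q₂₂f : ((↥(pbox (towerTorus Lc M' (n + 1))) × Fin (d + 1)) → ℝ) → ((↥(pbox (towerTorus Lc M' (n + 1))) × Fin (d + 1)) → ℝ) → Matrix κ (↥(pbox M') × Fin (d + 1)) ℝ)
    (hQ₂₂f : ∀ w w', Q₂₂f w w' = ((Lc : ℝ) ^ (d + 1) * stepScale d Lc (lev 0))⁻¹ •
        ∑ b : ↥(pbox M') × Fin (d + 1), ∑ b' : ↥(pbox M') × Fin (d + 1),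
          (((c * (((Lc : ℝ) ^ (d + 1) * stepScale d Lc (lev 0)) * (∏ i ∈ range (n + 1), (stepScale d Lc (lev (i + 1)) * ((box (d + 1) Lc).card : ℝ)))⁻¹)) * (compRows Lc M' lev rs (n + 1) *ᵥ w) b)
            * ((c * (((Lc : ℝ) ^ (d + 1) * stepScale d Lc (lev 0)) * (∏ i ∈ range (n + 1), (stepScale d Lc (lev (i + 1)) * ((box (d + 1) Lc).card : ℝ)))⁻¹)) * (compRows Lc M' lev rs (n + 1) *ᵥ w') b')) •
          (perF M' (dper M' (fun x z a e => ∑' m : Site (d + 1), (1 / 2 : ℝ) *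
            (vh₂SAt (toSite (rs 0)) Lc b.2 (b.1 : Site (d + 1)) b'.2 (translate M' (b'.1 : Site (d + 1)) m) x z a e
              + vh₂SAt (toSite (rs 0)) Lc b'.2 (translate M' (b'.1 : Site (d + 1)) m) b.2 (b.1 : Site (d + 1)) x z a e)))).submatrix
            (fun k : κ => ((pμ' k, Sum.inr (mμ' k)) : Idx M' (Fib d))) (fun e : ↥(pbox M') × Fin (d + 1) => ((e.1, Sum.inl e.2) : Idx M' (Fib d))))
    (hQ₂₁ : Q₂₁ = Q₂₁f h) (hQ₂₂ : Q₂₂ = Q₂₂f h h)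
    (Y₁ Y₂ : Matrix κ (NParam Lc M' rs (n + 1)) ℝ)
    -- the chart transport (exponential currency): generators `X` (finest fields), `X̄` (coarse multipliers); one-shot chart's generator jets; parameter-transport jets
    {X : Matrix (↥(pbox (towerTorus Lc M' (n + 1))) × Fin (d + 1)) (↥(pbox (towerTorus Lc M' (n + 1))) × Fin (d + 1)) ℝ} (hX : X = -(c • Matrix.diagonal (fun b : (↥(pbox (towerTorus Lc M' (n + 1))) × Fin (d + 1)) => lam b.1)))
    {W'₁ W'₂ : Matrix (↥(pbox (towerTorus Lc M' (n + 1))) × Fin (d + 1)) (NParam Lc M' rs (n + 1)) ℝ}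
    (hW'₁ : W'₁ = Matrix.of fun (b : (↥(pbox (towerTorus Lc M' (n + 1))) × Fin (d + 1))) (e : NParam Lc M' rs (n + 1)) =>
        -(c * (h b + ∑ s, tgrad (towerTorus Lc M' (n + 1)) (b.1, Sum.inl b.2) s * lam s) * evalN Lc M' rs (n + 1) (fun b' : (↥(pbox (towerTorus Lc M' (n + 1))) × Fin (d + 1)) => (b'.1 : Site (d + 1)) + unitVec b'.2) b e))
    (hW'₂ : W'₂ = Matrix.of fun (b : (↥(pbox (towerTorus Lc M' (n + 1))) × Fin (d + 1))) (e : NParam Lc M' rs (n + 1)) =>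
        (c * (h b + ∑ s, tgrad (towerTorus Lc M' (n + 1)) (b.1, Sum.inl b.2) s * lam s)) ^ 2 * evalN Lc M' rs (n + 1) (fun b' : (↥(pbox (towerTorus Lc M' (n + 1))) × Fin (d + 1)) => (b'.1 : Site (d + 1)) + unitVec b'.2) b e)
    {C₁ C₂ : Matrix (NParam Lc M' rs (n + 1)) (NParam Lc M' rs (n + 1)) ℝ} (hC₁ : C₁ = c • towerC₁ Lc M' rs (fun k => toSite_mem_range (hrs k)) (n + 1) lam) (hC₂ : C₂ = C₁ * C₁)
    {𝔔₀ 𝔔₁ 𝔔₂ : Matrix κ (↥(pbox (towerTorus Lc M' (n + 1))) × Fin (d + 1)) ℝ}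
    (h𝔔₀ : Q₂₀ * Q₁₀ = 𝔔₀) (h𝔔₁ : Q₂₁ * Q₁₀ + Q₂₀ * Q₁₁ = 𝔔₁) (h𝔔₂ : Q₂₂ * Q₁₀ + Q₂₁ * Q₁₁ + (Q₂₁ * Q₁₁ + Q₂₀ * Q₁₂) = 𝔔₂)
    -- (T-β-m) GRADED: the one-shot literal's composite jets are the graded `X`-conjugated words, NAMED
    {H'₁ H'₂ : Matrix (↥(pbox (towerTorus Lc M' (n + 1))) × Fin (d + 1)) (↥(pbox (towerTorus Lc M' (n + 1))) × Fin (d + 1)) ℝ}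
    {𝔔'₁ 𝔔'₂ : Matrix κ (↥(pbox (towerTorus Lc M' (n + 1))) × Fin (d + 1)) ℝ}
    (k1 : -(Xᵀ * H₀) + H₁ + H₀ * X = H'₁)
    (k2 : (X * X)ᵀ * H₀ + (-(Xᵀ * H₁) + -(Xᵀ * H₀ * X)) + ((-(Xᵀ * H₁) + -(Xᵀ * H₀ * X)) + (H₂ + H₁ * X + (H₁ * X + H₀ * (X * X)))) = H'₂)
    -- `q1 q2` DISCHARGED (g22 `torus_q1_tower`, R-3 `torus_q2_tower`): the transported jets ARE the composite's jets at the gauge-shifted direction `h + Dλ`, NAMED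
    (h𝔔'₁ : Q₂₁f (fun b : ↥(pbox (towerTorus Lc M' (n + 1))) × Fin (d + 1) => h b + ∑ s : ↥(pbox (towerTorus Lc M' (n + 1))), tgrad (towerTorus Lc M' (n + 1)) (b.1, Sum.inl b.2) s * lam s)
          * compRows Lc M' lev rs (n + 1)
        + Q₂₀ * (c • compIns₁ Lc M' lev rs (n + 1) (fun b : ↥(pbox (towerTorus Lc M' (n + 1))) × Fin (d + 1) => h b + ∑ s : ↥(pbox (towerTorus Lc M' (n + 1))), tgrad (towerTorus Lc M' (n + 1)) (b.1, Sum.inl b.2) s * lam s)) = 𝔔'₁)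
    (h𝔔'₂ : Q₂₂f (fun b : ↥(pbox (towerTorus Lc M' (n + 1))) × Fin (d + 1) => h b + ∑ s : ↥(pbox (towerTorus Lc M' (n + 1))), tgrad (towerTorus Lc M' (n + 1)) (b.1, Sum.inl b.2) s * lam s)
            (fun b : ↥(pbox (towerTorus Lc M' (n + 1))) × Fin (d + 1) => h b + ∑ s : ↥(pbox (towerTorus Lc M' (n + 1))), tgrad (towerTorus Lc M' (n + 1)) (b.1, Sum.inl b.2) s * lam s) * compRows Lc M' lev rs (n + 1)
        + Q₂₁f (fun b : ↥(pbox (towerTorus Lc M' (n + 1))) × Fin (d + 1) => h b + ∑ s : ↥(pbox (towerTorus Lc M' (n + 1))), tgrad (towerTorus Lc M' (n + 1)) (b.1, Sum.inl b.2) s * lam s)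
          * (c • compIns₁ Lc M' lev rs (n + 1) (fun b : ↥(pbox (towerTorus Lc M' (n + 1))) × Fin (d + 1) => h b + ∑ s : ↥(pbox (towerTorus Lc M' (n + 1))), tgrad (towerTorus Lc M' (n + 1)) (b.1, Sum.inl b.2) s * lam s))
        + (Q₂₁f (fun b : ↥(pbox (towerTorus Lc M' (n + 1))) × Fin (d + 1) => h b + ∑ s : ↥(pbox (towerTorus Lc M' (n + 1))), tgrad (towerTorus Lc M' (n + 1)) (b.1, Sum.inl b.2) s * lam s)
            * (c • compIns₁ Lc M' lev rs (n + 1) (fun b : ↥(pbox (towerTorus Lc M' (n + 1))) × Fin (d + 1) => h b + ∑ s : ↥(pbox (towerTorus Lc M' (n + 1))), tgrad (towerTorus Lc M' (n + 1)) (b.1, Sum.inl b.2) s * lam s))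
          + Q₂₀ * (c ^ 2 • compIns₂ Lc M' lev rs (n + 1) (fun b : ↥(pbox (towerTorus Lc M' (n + 1))) × Fin (d + 1) => h b + ∑ s : ↥(pbox (towerTorus Lc M' (n + 1))), tgrad (towerTorus Lc M' (n + 1)) (b.1, Sum.inl b.2) s * lam s))) = 𝔔'₂)
    -- (T-β-4) `j1 j2 uC` DISCHARGED (leaf-06 `TorusCompositeIntertwining.torus_j1_tower ∕ torus_j2_tower`, `TorusGeneratorIntertwining.torus_uC_exp`)
    -- (INV-m) `h1` and (EFF-m) `h2` are DISCHARGED inside: leaf-05 `torus_composite_inv_and_eff` for the NESTED slice, transferred to the one-shot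
    -- slice by an2's Literature `GaugeFixingPropagators.isUnit_det_kkt_sliceChange₃ ∕ blocks_sliceChange₃` (R-FP-55 (R3))
    {Γ : Matrix (↥(pbox (towerTorus Lc M' (n + 1))) × Fin (d + 1)) (↥(pbox (towerTorus Lc M' (n + 1))) × Fin (d + 1)) ℝ}
    {I : Matrix (↥(pbox (towerTorus Lc M' (n + 1))) × Fin (d + 1)) ((↥(pbox M') × Fin (d + 1)) ⊕ NParam Lc (fine Lc M') (fun k => rs (k + 1)) n) ℝ}
    {L : Matrix ((↥(pbox M') × Fin (d + 1)) ⊕ NParam Lc (fine Lc M') (fun k => rs (k + 1)) n) (↥(pbox (towerTorus Lc M' (n + 1))) × Fin (d + 1)) ℝ}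
    {S : Matrix ((↥(pbox M') × Fin (d + 1)) ⊕ NParam Lc (fine Lc M') (fun k => rs (k + 1)) n)
      ((↥(pbox M') × Fin (d + 1)) ⊕ NParam Lc (fine Lc M') (fun k => rs (k + 1)) n) ℝ}
    {B : Matrix ((↥(pbox M') × Fin (d + 1)) ⊕ NParam Lc (fine Lc M') (fun k => rs (k + 1)) n) (↥(pbox (towerTorus Lc M' (n + 1))) × Fin (d + 1)) ℝ}
    (hΓ : flucCov H₀ (fromRows Q₁₀ τ₁) = Γ) (hI : minOp H₀ (fromRows Q₁₀ τ₁) = I) (hL : minOpL H₀ (fromRows Q₁₀ τ₁) = L) (hS : effForm H₀ (fromRows Q₁₀ τ₁) = S)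
    (hB : fromRows Q₁₁ (0 : Matrix (NParam Lc (fine Lc M') (fun k => rs (k + 1)) n) (↥(pbox (towerTorus Lc M' (n + 1))) × Fin (d + 1)) ℝ) = B)
    -- (SLICE-m) ALL DISCHARGED but ONE primitive letter (R-FP-56): `hPW uP'` (leaf-06 g20), `hTW` (leaf-06 g21), the nested Faddeev–Popov 2-jet `uT` by
    -- leaf-06 g21's SPLIT `NestedFPSplit.secondVar_nestedFP_eq_zero_of_blocks` (block lower-triangular under `c0 c1 c2`; fine block `uLow` AUTOMATIC —
    -- `torus_uLow_oneShot_tower`; coarse block = THIS letter); DISPLAYED: «the coarse chart's Faddeev–Popov 2-jet along the composite insertion jets'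
    -- coarse images vanishes» — produced by `CoarseFPExponential.torus_uTop_of_sq_on_comb ∕ _of_exp_on_comb ∕ _of_dead` or `CoarseFPDefect` (leaf-06 g22)
    (uTop : secondVar (τ₂ * Dbar) (τ₂ * Db₁) (τ₂ * Db₂) = 0)
    -- parities of the displayed form jets; the GRADED Ward rows of the finest form against the composite witnesses (NO transposed rows)
    (hH₁t : H₁ᵀ = -H₁) (hH₂t : H₂ᵀ = H₂)
    -- (WARD-m) ORDER 0 DISCHARGED in #21; orders 1, 2 at `Y₀ := 0`, displayed (leaf-05's)
    (a1 : H₁ * W₀ + H₀ * W₁ = 𝔔₀ᵀ * Y₁)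
    (a2 : H₂ * W₀ + (2 : ℝ) • (H₁ * W₁) + H₀ * W₂ = -((2 : ℝ) • (𝔔₁ᵀ * Y₁)) + 𝔔₀ᵀ * Y₂) :
    secondVar (kkt H₀ (fromRows 𝔔₀ P))
        (fromBlocks H'₁ (-(fromRows 𝔔'₁ (0 : Matrix (NParam Lc M' rs (n + 1)) (↥(pbox (towerTorus Lc M' (n + 1))) × Fin (d + 1)) ℝ))ᵀ)
          (fromRows 𝔔'₁ (0 : Matrix (NParam Lc M' rs (n + 1)) (↥(pbox (towerTorus Lc M' (n + 1))) × Fin (d + 1)) ℝ)) 0)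
        (kkt H'₂ (fromRows 𝔔'₂ (0 : Matrix (NParam Lc M' rs (n + 1)) (↥(pbox (towerTorus Lc M' (n + 1))) × Fin (d + 1)) ℝ)))
      = secondVar (kkt H₀ (fromRows Q₁₀ τ₁)) (fromBlocks H₁ (-Bᵀ) B 0)
            (kkt H₂ (fromRows Q₁₂ (0 : Matrix (NParam Lc (fine Lc M') (fun k => rs (k + 1)) n) (↥(pbox (towerTorus Lc M' (n + 1))) × Fin (d + 1)) ℝ)))
        + secondVar
            (kkt S.toBlocks₁₁ (fromRows Q₂₀ τ₂))
            (fromBlocks ((L * H₁ - S * B) * I + L * Bᵀ * S).toBlocks₁₁ (-(fromRows Q₂₁ (0 : Matrix (Res (toSite (rs 0)) Lc M') (↥(pbox M') × Fin (d + 1)) ℝ))ᵀ)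
              (fromRows Q₂₁ (0 : Matrix (Res (toSite (rs 0)) Lc M') (↥(pbox M') × Fin (d + 1)) ℝ)) 0)
            (kkt (((-((L * H₁ - S * B) * Γ - L * Bᵀ * L) * H₁ + L * H₂
                      - (((L * H₁ - S * B) * I + L * Bᵀ * S) * B
                          + S * fromRows Q₁₂ (0 : Matrix (NParam Lc (fine Lc M') (fun k => rs (k + 1)) n) (↥(pbox (towerTorus Lc M' (n + 1))) × Fin (d + 1)) ℝ))) * I
                    + (L * H₁ - S * B) * (-((Γ * H₁ + I * B) * I + Γ * Bᵀ * S)))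
                  - ((-((L * H₁ - S * B) * Γ - L * Bᵀ * L) * (-Bᵀ)
                        + L * (fromRows Q₁₂ (0 : Matrix (NParam Lc (fine Lc M') (fun k => rs (k + 1)) n) (↥(pbox (towerTorus Lc M' (n + 1))) × Fin (d + 1)) ℝ))ᵀ) * S
                      + L * (-Bᵀ) * ((L * H₁ - S * B) * I + L * Bᵀ * S))).toBlocks₁₁
              (fromRows Q₂₂ (0 : Matrix (Res (toSite (rs 0)) Lc M') (↥(pbox M') × Fin (d + 1)) ℝ))) := by
  subst hQ₁₀ hW₀ hQ₂₀ hDbar hX hQ₁₁ hQ₁₂ hQ₂₁ hQ₂₂ hDb₁ hDb₂ h𝔔'₁ h𝔔'₂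
  -- the six ♭ rows BY TERM (C2 ∕ I-5 ∕ g22 ∕ R-3)
  have c1 := torus_c1_tower Lc M' lev rs hrs n c h hW₁
  have c2 := torus_c2_tower Lc M' lev rs hrs n c h hW₁ hW₂
  have d1 := torus_d1_tower Lc M' lev rs hrs hM' n c h pμ' mμ'
  have d2 := torus_d2_tower Lc M' lev rs hrs hM' n c h pμ' mμ'
  have q1 := torus_q1_tower Lc M' lev rs hrs hM' n c h lam pμ' mμ' rfl Q₂₁f hQ₂₁f h𝔔₀ h𝔔₁
  have q2 := torus_q2_tower Lc M' lev rs hrs hM' n c h lam pμ' mμ' rfl Q₂₁f hQ₂₁f Q₂₂f hQ₂₂f rfl rfl h𝔔₀ h𝔔₁ h𝔔₂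
  rw [← hQ₂₁f h] at d1
  rw [← hQ₂₁f h, ← hQ₂₂f h h] at d2
  exact secondVar_oneShot_nestedStepLaw_torus_composite_graded_oneShot_of_uTop M' Lc lev rs n hrs hlev hM' pμ' mμ' hfμ' hcoarse' hH₀ rfl hτ₁ hτ₂ rfl rfl hP
    H₁ H₂ _ _ _ _ lam c h hW₁ hW₂ rfl _ _ Y₁ Y₂ rfl _ hW'₁ hW'₂ hC₁ hC₂ h𝔔₀ h𝔔₁ h𝔔₂ k1 k2 q1 q2 hΓ hI hL hS hB uTop hH₁t hH₂t a1 a2 c1 c2 d1 d2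

set_option synthInstance.maxSize 1024 in
/-- [folklore] **#21♭ CLOSED ON THE SLICE SIDE — the direction is the NESTED COMPOSITE COLUMN `h := minOp H₀ [Q₁₀;τ₁] · (v, 0)`, `v := minOp S₁₁ [Q₂₀;τ₂] · (h̄, 0)` of a coarse
source `h̄ : κ → ℝ`** (leaf-06 g27 `NestedDeadRowsOrderTwoTowerClosed.torus_uTop_tower_closed`'s `hbar hv hh` VERBATIM): `…_of_uTop_pure` with `uTop` DISCHARGED by leaf-06's term
(its `hDb₁ hDb₂` are ours); displayed ONLY the pins, `H₁ H₂`, `lam c`, `hbar hv hh`, the generator jets, `h𝔔ᵢ`, `k1 k2`, `hΓ hI hL hS hB`, `hH₁t hH₂t`, `a1 a2`. -/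
theorem secondVar_oneShot_nestedStepLaw_torus_composite_graded_oneShot_of_uTop_pure_closed (hrs : ∀ k, rs k ∈ box (d + 1) Lc) (hlev : ∀ i, lev i = lev (i + 1) + 1)
    (hM' : ∀ i, Lc ∣ M' i)
    -- the coarse multipliers' slot presentation one level above `M′` (as (B): injective, `inr`-valued, exactly the `Lc`-coarse sites of `M′`)
    {κ : Type*} [Fintype κ] [DecidableEq κ] (pμ' : κ → ↥(pbox M')) (mμ' : κ → Fin (d + 1))
    (hfμ' : Function.Injective (fun a : κ => ((pμ' a, Sum.inr (mμ' a)) : Idx M' (Fib d))))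
    (hcoarse' : ∀ (s : ↥(pbox M')) (m : Fin (d + 1)),
      ((s, Sum.inr m) : Idx M' (Fib d)) ∈ Set.range (fun a : κ => ((pμ' a, Sum.inr (mμ' a)) : Idx M' (Fib d))) ↔ Torus.proj Lc (s : Site (d + 1)) = 0)
    -- the composite objects of record, PINNED by defining equations (leaf-06 `TorusCompositeObjects`)
    {H₀ : Matrix (↥(pbox (towerTorus Lc M' (n + 1))) × Fin (d + 1)) (↥(pbox (towerTorus Lc M' (n + 1))) × Fin (d + 1)) ℝ}
    {Q₁₀ : Matrix (↥(pbox M') × Fin (d + 1)) (↥(pbox (towerTorus Lc M' (n + 1))) × Fin (d + 1)) ℝ}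
    {τ₁ : Matrix (NParam Lc (fine Lc M') (fun k => rs (k + 1)) n) (↥(pbox (towerTorus Lc M' (n + 1))) × Fin (d + 1)) ℝ}
    (hH₀ : H₀ = (perF (towerTorus Lc M' (n + 1)) (bhKStepAt d (toSite (rs (n + 1))) Lc (lev (n + 1)))).submatrix
        (fun b : ↥(pbox (towerTorus Lc M' (n + 1))) × Fin (d + 1) => ((b.1, Sum.inl b.2) : Idx (towerTorus Lc M' (n + 1)) (Fib d)))
        (fun b : ↥(pbox (towerTorus Lc M' (n + 1))) × Fin (d + 1) => ((b.1, Sum.inl b.2) : Idx (towerTorus Lc M' (n + 1)) (Fib d))))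
    (hQ₁₀ : Q₁₀ = compRows Lc M' lev rs (n + 1))
    -- R-FP-55 (α): the fine slice is the ONE-SHOT big comb of the tower below (leaf-06 `bigP`), NOT the nested slice
    (hτ₁ : τ₁ = bigP Lc (fine Lc M') (fun k => rs (k + 1)) (fun k => toSite_mem_range (hrs (k + 1))) n)
    {τ₂ : Matrix (Res (toSite (rs 0)) Lc M') (↥(pbox M') × Fin (d + 1)) ℝ} (hτ₂ : τ₂ = combF Lc M' (rs 0))
    -- the top step's averaging rows (level `lev 0`, root `rs 0`), PINNED as (B)'s `hQ₂₀`
    {Q₂₀ : Matrix κ (↥(pbox M') × Fin (d + 1)) ℝ}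
    (hQ₂₀ : Q₂₀ = (perF M' (bhKStepAt d (toSite (rs 0)) Lc (lev 0))).submatrix (fun a : κ => ((pμ' a, Sum.inr (mμ' a)) : Idx M' (Fib d)))
        (fun b : ↥(pbox M') × Fin (d + 1) => ((b.1, Sum.inl b.2) : Idx M' (Fib d))))
    -- the tower's generators and the one-shot big comb: FREE matrices of the tower's types in v1 (pinned to leaf-06's `towerGen ∕ bigP` by the (SLICE-m) ∕
    -- (COV-m) suppliers in v1.1; target shape 36f428fe4d8b64c2)
    {W₀ : Matrix (↥(pbox (towerTorus Lc M' (n + 1))) × Fin (d + 1)) (NParam Lc M' rs (n + 1)) ℝ} (hW₀ : W₀ = towerGen Lc M' rs (n + 1))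
    {P : Matrix (NParam Lc M' rs (n + 1)) (↥(pbox (towerTorus Lc M' (n + 1))) × Fin (d + 1)) ℝ} (hP : P = bigP Lc M' rs (fun k => toSite_mem_range (hrs k)) (n + 1))
    -- the displayed jets: form (finest level), composite averaging, the top step's averaging jets, generators, witnesses, composite covariance images
    (H₁ H₂ : Matrix (↥(pbox (towerTorus Lc M' (n + 1))) × Fin (d + 1)) (↥(pbox (towerTorus Lc M' (n + 1))) × Fin (d + 1)) ℝ)
    -- (COV-m) ∕ (T-β-m) ORDERS 1, 2 BOUND (this file): the composite averaging's insertion jets `Q₁₁ Q₁₂` and the top step's `Q₂₁ Q₂₂` by DEFINING EQUATIONS below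
    {Q₁₁ Q₁₂ : Matrix (↥(pbox M') × Fin (d + 1)) (↥(pbox (towerTorus Lc M' (n + 1))) × Fin (d + 1)) ℝ}
    {Q₂₁ Q₂₂ : Matrix κ (↥(pbox M') × Fin (d + 1)) ℝ}
    -- the finest-level transport generator `X = −c·diag(λ)`, the tower's generator jets `W₁ W₂` (weight `h`) and the one-shot generator jets `W′₁ W′₂`
    -- (weight `h + Dλ`) PINNED to the exponential closed forms of leaf-06's `TorusCompositeIntertwining` ∕ `TorusCompositeFP` (parameters `λ`, `c`, `h`)
    (lam : ↥(pbox (towerTorus Lc M' (n + 1))) → ℝ) (c : ℝ)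
    -- the direction is the NESTED COMPOSITE COLUMN of a coarse source `hbar` (leaf-06 `NestedDeadRowsOrderTwoTowerClosed.torus_uTop_tower_closed`'s `hv hh` VERBATIM)
    (hbar : κ → ℝ)
    {v : ↥(pbox M') × Fin (d + 1) → ℝ} (hv : v = minOp (effForm H₀ (fromRows Q₁₀ τ₁)).toBlocks₁₁ (fromRows Q₂₀ τ₂) *ᵥ Sum.elim hbar 0)
    {h : (↥(pbox (towerTorus Lc M' (n + 1))) × Fin (d + 1)) → ℝ} (hh : h = minOp H₀ (fromRows Q₁₀ τ₁) *ᵥ Sum.elim v 0)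
    {W₁ W₂ : Matrix (↥(pbox (towerTorus Lc M' (n + 1))) × Fin (d + 1)) (NParam Lc M' rs (n + 1)) ℝ}
    (hW₁ : W₁ = Matrix.of fun (b : (↥(pbox (towerTorus Lc M' (n + 1))) × Fin (d + 1))) (e : NParam Lc M' rs (n + 1)) => -(c * h b * evalN Lc M' rs (n + 1) (fun b' : (↥(pbox (towerTorus Lc M' (n + 1))) × Fin (d + 1)) => (b'.1 : Site (d + 1)) + unitVec b'.2) b e))
    (hW₂ : W₂ = Matrix.of fun (b : (↥(pbox (towerTorus Lc M' (n + 1))) × Fin (d + 1))) (e : NParam Lc M' rs (n + 1)) => (c * h b) ^ 2 * evalN Lc M' rs (n + 1) (fun b' : (↥(pbox (towerTorus Lc M' (n + 1))) × Fin (d + 1)) => (b'.1 : Site (d + 1)) + unitVec b'.2) b e)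
    -- (COV-m) ORDER 0 PINNED (leaf-02 g21 `TorusCompositeCovariance`): `Dbar := σ_{n+1} • D̄`; the orders 1, 2 images stay displayed
    {Dbar : Matrix (↥(pbox M') × Fin (d + 1)) (Res (toSite (rs 0)) Lc M') ℝ}
    (hDbar : Dbar = (∏ i ∈ range (n + 1), (stepScale d Lc (lev (i + 1)) * ((box (d + 1) Lc).card : ℝ))) •
        (tgrad M').submatrix (fun a : ↥(pbox M') × Fin (d + 1) => ((a.1, Sum.inl a.2) : Idx M' (Fib d))) (fun t : Res (toSite (rs 0)) Lc M' => (t.1 : ↥(pbox M'))))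
    {Db₁ Db₂ : Matrix (↥(pbox M') × Fin (d + 1)) (Res (toSite (rs 0)) Lc M') ℝ}
    (hDb₁ : Db₁ = Matrix.of fun (a : ↥(pbox M') × Fin (d + 1)) (t : Res (toSite (rs 0)) Lc M') =>
        -(c * (compRows Lc M' lev rs (n + 1) *ᵥ h) a * tdelta M' ((a.1 : Site (d + 1)) + unitVec a.2) t.1))
    (hDb₂ : Db₂ = Matrix.of fun (a : ↥(pbox M') × Fin (d + 1)) (t : Res (toSite (rs 0)) Lc M') =>
        (c ^ 2 * (∏ i ∈ range (n + 1), (stepScale d Lc (lev (i + 1)) * ((box (d + 1) Lc).card : ℝ)))⁻¹)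
          * ((compRows Lc M' lev rs (n + 1) *ᵥ h) a) ^ 2 * tdelta M' ((a.1 : Site (d + 1)) + unitVec a.2) t.1)
    -- the bindings of `Q₁₁ Q₁₂` (C2 ∕ I-5: OUR composite insertion jets along `h`) and of `Q₂₁ Q₂₂` (the top step's rooted member ∕ ♭ bi-member along the
    -- transported direction `(cθ_{n+1})•(compRows·w)`, as FUNCTIONS of the weight(s) — g22 `torus_q1_tower` ∕ I-5 ∕ R-3 `torus_q2_tower` shapes)
    (hQ₁₁ : Q₁₁ = c • compIns₁ Lc M' lev rs (n + 1) h) (hQ₁₂ : Q₁₂ = c ^ 2 • compIns₂ Lc M' lev rs (n + 1) h)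
    (Q₂₁f : ((↥(pbox (towerTorus Lc M' (n + 1))) × Fin (d + 1)) → ℝ) → Matrix κ (↥(pbox M') × Fin (d + 1)) ℝ)
    (hQ₂₁f : ∀ w, Q₂₁f w = ∑ a' : ↥(pbox M') × Fin (d + 1),
        ((c * (((Lc : ℝ) ^ (d + 1) * stepScale d Lc (lev 0)) * (∏ i ∈ range (n + 1), (stepScale d Lc (lev (i + 1)) * ((box (d + 1) Lc).card : ℝ)))⁻¹))
          * (compRows Lc M' lev rs (n + 1) *ᵥ w) a') •
        (perF M' (dper M' (vhSAt (toSite (rs 0)) d Lc rfl a'.2 (a'.1 : Site (d + 1))))).submatrix (fun k : κ => ((pμ' k, Sum.inr (mμ' k)) : Idx M' (Fib d)))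
          (fun b : ↥(pbox M') × Fin (d + 1) => ((b.1, Sum.inl b.2) : Idx M' (Fib d))))
    (Q₂₂f : ((↥(pbox (towerTorus Lc M' (n + 1))) × Fin (d + 1)) → ℝ) → ((↥(pbox (towerTorus Lc M' (n + 1))) × Fin (d + 1)) → ℝ) → Matrix κ (↥(pbox M') × Fin (d + 1)) ℝ)
    (hQ₂₂f : ∀ w w', Q₂₂f w w' = ((Lc : ℝ) ^ (d + 1) * stepScale d Lc (lev 0))⁻¹ •
        ∑ b : ↥(pbox M') × Fin (d + 1), ∑ b' : ↥(pbox M') × Fin (d + 1),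
          (((c * (((Lc : ℝ) ^ (d + 1) * stepScale d Lc (lev 0)) * (∏ i ∈ range (n + 1), (stepScale d Lc (lev (i + 1)) * ((box (d + 1) Lc).card : ℝ)))⁻¹)) * (compRows Lc M' lev rs (n + 1) *ᵥ w) b)
            * ((c * (((Lc : ℝ) ^ (d + 1) * stepScale d Lc (lev 0)) * (∏ i ∈ range (n + 1), (stepScale d Lc (lev (i + 1)) * ((box (d + 1) Lc).card : ℝ)))⁻¹)) * (compRows Lc M' lev rs (n + 1) *ᵥ w') b')) •
          (perF M' (dper M' (fun x z a e => ∑' m : Site (d + 1), (1 / 2 : ℝ) *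
            (vh₂SAt (toSite (rs 0)) Lc b.2 (b.1 : Site (d + 1)) b'.2 (translate M' (b'.1 : Site (d + 1)) m) x z a e
              + vh₂SAt (toSite (rs 0)) Lc b'.2 (translate M' (b'.1 : Site (d + 1)) m) b.2 (b.1 : Site (d + 1)) x z a e)))).submatrix
            (fun k : κ => ((pμ' k, Sum.inr (mμ' k)) : Idx M' (Fib d))) (fun e : ↥(pbox M') × Fin (d + 1) => ((e.1, Sum.inl e.2) : Idx M' (Fib d))))
    (hQ₂₁ : Q₂₁ = Q₂₁f h) (hQ₂₂ : Q₂₂ = Q₂₂f h h)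
    (Y₁ Y₂ : Matrix κ (NParam Lc M' rs (n + 1)) ℝ)
    -- the chart transport (exponential currency): generators `X` (finest fields), `X̄` (coarse multipliers); one-shot chart's generator jets; parameter-transport jets
    {X : Matrix (↥(pbox (towerTorus Lc M' (n + 1))) × Fin (d + 1)) (↥(pbox (towerTorus Lc M' (n + 1))) × Fin (d + 1)) ℝ} (hX : X = -(c • Matrix.diagonal (fun b : (↥(pbox (towerTorus Lc M' (n + 1))) × Fin (d + 1)) => lam b.1)))
    {W'₁ W'₂ : Matrix (↥(pbox (towerTorus Lc M' (n + 1))) × Fin (d + 1)) (NParam Lc M' rs (n + 1)) ℝ}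
    (hW'₁ : W'₁ = Matrix.of fun (b : (↥(pbox (towerTorus Lc M' (n + 1))) × Fin (d + 1))) (e : NParam Lc M' rs (n + 1)) =>
        -(c * (h b + ∑ s, tgrad (towerTorus Lc M' (n + 1)) (b.1, Sum.inl b.2) s * lam s) * evalN Lc M' rs (n + 1) (fun b' : (↥(pbox (towerTorus Lc M' (n + 1))) × Fin (d + 1)) => (b'.1 : Site (d + 1)) + unitVec b'.2) b e))
    (hW'₂ : W'₂ = Matrix.of fun (b : (↥(pbox (towerTorus Lc M' (n + 1))) × Fin (d + 1))) (e : NParam Lc M' rs (n + 1)) =>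
        (c * (h b + ∑ s, tgrad (towerTorus Lc M' (n + 1)) (b.1, Sum.inl b.2) s * lam s)) ^ 2 * evalN Lc M' rs (n + 1) (fun b' : (↥(pbox (towerTorus Lc M' (n + 1))) × Fin (d + 1)) => (b'.1 : Site (d + 1)) + unitVec b'.2) b e)
    {C₁ C₂ : Matrix (NParam Lc M' rs (n + 1)) (NParam Lc M' rs (n + 1)) ℝ} (hC₁ : C₁ = c • towerC₁ Lc M' rs (fun k => toSite_mem_range (hrs k)) (n + 1) lam) (hC₂ : C₂ = C₁ * C₁)
    {𝔔₀ 𝔔₁ 𝔔₂ : Matrix κ (↥(pbox (towerTorus Lc M' (n + 1))) × Fin (d + 1)) ℝ}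
    (h𝔔₀ : Q₂₀ * Q₁₀ = 𝔔₀) (h𝔔₁ : Q₂₁ * Q₁₀ + Q₂₀ * Q₁₁ = 𝔔₁) (h𝔔₂ : Q₂₂ * Q₁₀ + Q₂₁ * Q₁₁ + (Q₂₁ * Q₁₁ + Q₂₀ * Q₁₂) = 𝔔₂)
    -- (T-β-m) GRADED: the one-shot literal's composite jets are the graded `X`-conjugated words, NAMED
    {H'₁ H'₂ : Matrix (↥(pbox (towerTorus Lc M' (n + 1))) × Fin (d + 1)) (↥(pbox (towerTorus Lc M' (n + 1))) × Fin (d + 1)) ℝ}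
    {𝔔'₁ 𝔔'₂ : Matrix κ (↥(pbox (towerTorus Lc M' (n + 1))) × Fin (d + 1)) ℝ}
    (k1 : -(Xᵀ * H₀) + H₁ + H₀ * X = H'₁)
    (k2 : (X * X)ᵀ * H₀ + (-(Xᵀ * H₁) + -(Xᵀ * H₀ * X)) + ((-(Xᵀ * H₁) + -(Xᵀ * H₀ * X)) + (H₂ + H₁ * X + (H₁ * X + H₀ * (X * X)))) = H'₂)
    -- `q1 q2` DISCHARGED (g22 `torus_q1_tower`, R-3 `torus_q2_tower`): the transported jets ARE the composite's jets at the gauge-shifted direction `h + Dλ`, NAMED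
    (h𝔔'₁ : Q₂₁f (fun b : ↥(pbox (towerTorus Lc M' (n + 1))) × Fin (d + 1) => h b + ∑ s : ↥(pbox (towerTorus Lc M' (n + 1))), tgrad (towerTorus Lc M' (n + 1)) (b.1, Sum.inl b.2) s * lam s)
          * compRows Lc M' lev rs (n + 1)
        + Q₂₀ * (c • compIns₁ Lc M' lev rs (n + 1) (fun b : ↥(pbox (towerTorus Lc M' (n + 1))) × Fin (d + 1) => h b + ∑ s : ↥(pbox (towerTorus Lc M' (n + 1))), tgrad (towerTorus Lc M' (n + 1)) (b.1, Sum.inl b.2) s * lam s)) = 𝔔'₁)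
    (h𝔔'₂ : Q₂₂f (fun b : ↥(pbox (towerTorus Lc M' (n + 1))) × Fin (d + 1) => h b + ∑ s : ↥(pbox (towerTorus Lc M' (n + 1))), tgrad (towerTorus Lc M' (n + 1)) (b.1, Sum.inl b.2) s * lam s)
            (fun b : ↥(pbox (towerTorus Lc M' (n + 1))) × Fin (d + 1) => h b + ∑ s : ↥(pbox (towerTorus Lc M' (n + 1))), tgrad (towerTorus Lc M' (n + 1)) (b.1, Sum.inl b.2) s * lam s) * compRows Lc M' lev rs (n + 1)
        + Q₂₁f (fun b : ↥(pbox (towerTorus Lc M' (n + 1))) × Fin (d + 1) => h b + ∑ s : ↥(pbox (towerTorus Lc M' (n + 1))), tgrad (towerTorus Lc M' (n + 1)) (b.1, Sum.inl b.2) s * lam s)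
          * (c • compIns₁ Lc M' lev rs (n + 1) (fun b : ↥(pbox (towerTorus Lc M' (n + 1))) × Fin (d + 1) => h b + ∑ s : ↥(pbox (towerTorus Lc M' (n + 1))), tgrad (towerTorus Lc M' (n + 1)) (b.1, Sum.inl b.2) s * lam s))
        + (Q₂₁f (fun b : ↥(pbox (towerTorus Lc M' (n + 1))) × Fin (d + 1) => h b + ∑ s : ↥(pbox (towerTorus Lc M' (n + 1))), tgrad (towerTorus Lc M' (n + 1)) (b.1, Sum.inl b.2) s * lam s)
            * (c • compIns₁ Lc M' lev rs (n + 1) (fun b : ↥(pbox (towerTorus Lc M' (n + 1))) × Fin (d + 1) => h b + ∑ s : ↥(pbox (towerTorus Lc M' (n + 1))), tgrad (towerTorus Lc M' (n + 1)) (b.1, Sum.inl b.2) s * lam s))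
          + Q₂₀ * (c ^ 2 • compIns₂ Lc M' lev rs (n + 1) (fun b : ↥(pbox (towerTorus Lc M' (n + 1))) × Fin (d + 1) => h b + ∑ s : ↥(pbox (towerTorus Lc M' (n + 1))), tgrad (towerTorus Lc M' (n + 1)) (b.1, Sum.inl b.2) s * lam s))) = 𝔔'₂)
    -- (T-β-4) `j1 j2 uC` DISCHARGED (leaf-06 `TorusCompositeIntertwining.torus_j1_tower ∕ torus_j2_tower`, `TorusGeneratorIntertwining.torus_uC_exp`)
    -- (INV-m) `h1` and (EFF-m) `h2` are DISCHARGED inside: leaf-05 `torus_composite_inv_and_eff` for the NESTED slice, transferred to the one-shot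
    -- slice by an2's Literature `GaugeFixingPropagators.isUnit_det_kkt_sliceChange₃ ∕ blocks_sliceChange₃` (R-FP-55 (R3))
    {Γ : Matrix (↥(pbox (towerTorus Lc M' (n + 1))) × Fin (d + 1)) (↥(pbox (towerTorus Lc M' (n + 1))) × Fin (d + 1)) ℝ}
    {I : Matrix (↥(pbox (towerTorus Lc M' (n + 1))) × Fin (d + 1)) ((↥(pbox M') × Fin (d + 1)) ⊕ NParam Lc (fine Lc M') (fun k => rs (k + 1)) n) ℝ}
    {L : Matrix ((↥(pbox M') × Fin (d + 1)) ⊕ NParam Lc (fine Lc M') (fun k => rs (k + 1)) n) (↥(pbox (towerTorus Lc M' (n + 1))) × Fin (d + 1)) ℝ}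
    {S : Matrix ((↥(pbox M') × Fin (d + 1)) ⊕ NParam Lc (fine Lc M') (fun k => rs (k + 1)) n)
      ((↥(pbox M') × Fin (d + 1)) ⊕ NParam Lc (fine Lc M') (fun k => rs (k + 1)) n) ℝ}
    {B : Matrix ((↥(pbox M') × Fin (d + 1)) ⊕ NParam Lc (fine Lc M') (fun k => rs (k + 1)) n) (↥(pbox (towerTorus Lc M' (n + 1))) × Fin (d + 1)) ℝ}
    (hΓ : flucCov H₀ (fromRows Q₁₀ τ₁) = Γ) (hI : minOp H₀ (fromRows Q₁₀ τ₁) = I) (hL : minOpL H₀ (fromRows Q₁₀ τ₁) = L) (hS : effForm H₀ (fromRows Q₁₀ τ₁) = S)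
    (hB : fromRows Q₁₁ (0 : Matrix (NParam Lc (fine Lc M') (fun k => rs (k + 1)) n) (↥(pbox (towerTorus Lc M' (n + 1))) × Fin (d + 1)) ℝ) = B)
    -- (SLICE-m) ENTIRELY DISCHARGED: `uTop` by leaf-06 g27 `torus_uTop_tower_closed` for the nested column (the ♭ square law of `Db₂`)
    -- parities of the displayed form jets; the GRADED Ward rows of the finest form against the composite witnesses (NO transposed rows)
    (hH₁t : H₁ᵀ = -H₁) (hH₂t : H₂ᵀ = H₂)
    -- (WARD-m) ORDER 0 DISCHARGED in #21; orders 1, 2 at `Y₀ := 0`, displayed (leaf-05's)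
    (a1 : H₁ * W₀ + H₀ * W₁ = 𝔔₀ᵀ * Y₁)
    (a2 : H₂ * W₀ + (2 : ℝ) • (H₁ * W₁) + H₀ * W₂ = -((2 : ℝ) • (𝔔₁ᵀ * Y₁)) + 𝔔₀ᵀ * Y₂) :
    secondVar (kkt H₀ (fromRows 𝔔₀ P))
        (fromBlocks H'₁ (-(fromRows 𝔔'₁ (0 : Matrix (NParam Lc M' rs (n + 1)) (↥(pbox (towerTorus Lc M' (n + 1))) × Fin (d + 1)) ℝ))ᵀ)
          (fromRows 𝔔'₁ (0 : Matrix (NParam Lc M' rs (n + 1)) (↥(pbox (towerTorus Lc M' (n + 1))) × Fin (d + 1)) ℝ)) 0)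
        (kkt H'₂ (fromRows 𝔔'₂ (0 : Matrix (NParam Lc M' rs (n + 1)) (↥(pbox (towerTorus Lc M' (n + 1))) × Fin (d + 1)) ℝ)))
      = secondVar (kkt H₀ (fromRows Q₁₀ τ₁)) (fromBlocks H₁ (-Bᵀ) B 0)
            (kkt H₂ (fromRows Q₁₂ (0 : Matrix (NParam Lc (fine Lc M') (fun k => rs (k + 1)) n) (↥(pbox (towerTorus Lc M' (n + 1))) × Fin (d + 1)) ℝ)))
        + secondVar
            (kkt S.toBlocks₁₁ (fromRows Q₂₀ τ₂))
            (fromBlocks ((L * H₁ - S * B) * I + L * Bᵀ * S).toBlocks₁₁ (-(fromRows Q₂₁ (0 : Matrix (Res (toSite (rs 0)) Lc M') (↥(pbox M') × Fin (d + 1)) ℝ))ᵀ)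
              (fromRows Q₂₁ (0 : Matrix (Res (toSite (rs 0)) Lc M') (↥(pbox M') × Fin (d + 1)) ℝ)) 0)
            (kkt (((-((L * H₁ - S * B) * Γ - L * Bᵀ * L) * H₁ + L * H₂
                      - (((L * H₁ - S * B) * I + L * Bᵀ * S) * B
                          + S * fromRows Q₁₂ (0 : Matrix (NParam Lc (fine Lc M') (fun k => rs (k + 1)) n) (↥(pbox (towerTorus Lc M' (n + 1))) × Fin (d + 1)) ℝ))) * I
                    + (L * H₁ - S * B) * (-((Γ * H₁ + I * B) * I + Γ * Bᵀ * S)))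
                  - ((-((L * H₁ - S * B) * Γ - L * Bᵀ * L) * (-Bᵀ)
                        + L * (fromRows Q₁₂ (0 : Matrix (NParam Lc (fine Lc M') (fun k => rs (k + 1)) n) (↥(pbox (towerTorus Lc M' (n + 1))) × Fin (d + 1)) ℝ))ᵀ) * S
                      + L * (-Bᵀ) * ((L * H₁ - S * B) * I + L * Bᵀ * S))).toBlocks₁₁
              (fromRows Q₂₂ (0 : Matrix (Res (toSite (rs 0)) Lc M') (↥(pbox M') × Fin (d + 1)) ℝ))) := by
  refine secondVar_oneShot_nestedStepLaw_torus_composite_graded_oneShot_of_uTop_pure M' Lc lev rs n hrs hlev hM' pμ' mμ' hfμ' hcoarse' hH₀ hQ₁₀ hτ₁ hτ₂ hQ₂₀ hW₀ hP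
    H₁ H₂ lam c h hW₁ hW₂ hDbar hDb₁ hDb₂ hQ₁₁ hQ₁₂ Q₂₁f hQ₂₁f Q₂₂f hQ₂₂f hQ₂₁ hQ₂₂ Y₁ Y₂ hX hW'₁ hW'₂ hC₁ hC₂ h𝔔₀ h𝔔₁ h𝔔₂ k1 k2 h𝔔'₁ h𝔔'₂ hΓ hI hL hS hB ?_
    hH₁t hH₂t a1 a2
  exact torus_uTop_tower_closed M' Lc lev rs n hrs hlev hM' pμ' mμ' hfμ' hcoarse' hH₀ hQ₁₀ hτ₁ hτ₂ hQ₂₀ hDbar hbar hv hh c hDb₁ hDb₂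

end Pure

end Summit.QuantumFields.BalabanUV.Beta.FP.NestedStepLawTorusCompositeOneShotTopPure

end
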